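import Literature.AlgebraicGeometry.HodgeTheory.WeilClassesFieldOneClass
import Literature.AlgebraicGeometry.HodgeTheory.WeilClassesFieldSubfieldDecomposable
import Literature.AlgebraicGeometry.HodgeTheory.HodgeTypeExteriorProduct
import HarnessLib

/-!
# «All or nothing» for the Weil classes of a field `F ⊂ End⁰(A)` of any degree: `W_F ⊗ ℂ` is the cyclic
# `ℂ[F^*]`-module on ANY non-zero rational Weil class; the Hodge / exceptional / algebraic dichotomies
# (Moonen–Zarhin 1998 §1, section «all or nothing», as printed)

Layer `Literature/AlgebraicGeometry/HodgeTheory`, theorem-only companion of `WeilClassesFieldOneClass` (the one-class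
lemma for ALGEBRAIC classes: one non-zero rational algebraic class of `W_F ⊗ ℂ` makes all of `W_F ⊗ ℂ` algebraic), of
`WeilClassesMoonenZarhinCriterion(Holds)` (`weilClassesField A φ P r = ⨆_{P(ρ)=0} ⋀ʳ V_{ℂ,ρ} ⊆ Hʳ(A(ℂ); ℂ)`, the
complexified space of Weil classes of the complex abelian variety `A` relative to the field `F = ℚ(φ) ≅ ℚ[T]/(P)`, and
the Criterion) and of `WeilClassesFieldSubfieldDecomposable` (exceptional classes relative to the complexified divisor
ring `Dᵐ ⊗ ℂ = Barriers.HodgeConjecture.divisorClassesSpan`).  Everything is proved; no definition, no named fact.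

PRINTED STATEMENT.  B. J. J. Moonen – Yu. G. Zarhin, *Weil classes on abelian varieties*, J. reine angew. Math. 496
(1998) 83–92 = arXiv:alg-geom/9612017 (held text `paper:arxiv-alg-geom_9612017`, chunk p0001, lines 57–66), §1, the
section labelled «all or nothing»: «The multiplicative group `F^*` acts on `⊕_i H^i(X,ℚ) ⊃ B^•(X) ⊇ D^•(X)` and on the
subspace `W_F ⊆ H^r(X,ℚ)`.  If the latter action is given by `ρ : F^* → Gl(W_F)` then its relation to the natural
structure of `F`-vector space on `W_F` is given by `ρ(f)(w) = f^r · w` for all `f ∈ F^*`, `w ∈ W`.  Since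
`dim_F(W_F) = 1`, it readily follows that either all elements of `W_F` are Hodge classes, or `0 ∈ W_F` is the only
Hodge class, and in the first case, either `W_F ∖ {0}` consists entirely of exceptional classes, or none of the
classes in `W_F` is exceptional.» (Introduction, ibid.: «We call a class `c ∈ B^•(X)` decomposable if it lies in the
subalgebra `D^•(X) ⊆ B^•(X)` generated by divisor classes.  The non-decomposable Hodge classes are called exceptional
classes.»)

RENDERING ON THE CARRIERS (as in the companion files).  `F = ℚ(φ)`, `φ : A ⟶ A`, `P(φ) = 0` in `End A` for
`P ∈ ℤ[T]` irreducible over `ℚ` of degree `e`, `e · r = 2 dim A`; `F^*`'s action on `Hʳ(A(ℂ); ℂ)` is read through the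
test pull-backs `(x·𝟙 + φ)^*`, `x ∈ ℕ` (every element of `F = ℚ[φ]` is a `ℚ`-polynomial in any one of them, and on the
summand `⋀ʳ V_{ℂ,σ}` of `W_F ⊗ ℂ` the pull-back `(x·𝟙 + y·φ)^*` IS the scalar `σ(x + yφ)ʳ = (x + yρ)ʳ` —
`mem_pullbackEigenclasses_iff`, the carrier form of «`ρ(f)(w) = f^r · w`»); «Hodge class» = rational class of Hodge
type `(p, q)` (`IsRationalClass`, `IsOfHodgeType`); «decomposable» = in `Dᵐ ⊗ ℂ = divisorClassesSpan A.X A.dim m`;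
«exceptional» = a Weil class NOT in `Dᵐ ⊗ ℂ`; the `ℚ`-structure `W_F ⊂ W_F ⊗ ℂ` is the set of RATIONAL classes of
`weilClassesField` (which span it: `weilClassesField_eq_span_isRationalClass`).

WHAT IS PROVED.
* §1 «`dim_F W_F = 1`» ON THE CARRIER: **`exists_weilClassesField_eq_span_pow_apply_of_isRationalClass`** — for ANY
  non-zero RATIONAL `γ ∈ W_F ⊗ ℂ` (`r ≠ 0`) there is a test endomorphism `x₀·𝟙 + φ` such that, with
  `T₀ = (x₀·𝟙 + φ)^*`, the `e = [F:ℚ]` rational classes `γ, T₀γ, …, T₀^{e-1}γ` are a `ℂ`-basis of `W_F ⊗ ℂ`: the space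
  of Weil classes is the cyclic `ℂ[F^*]`-module on any one of its non-zero rational points.
* §2 THE GENERAL ONE-CLASS LEMMA: **`weilClassesField_le_of_isRationalClass_of_ne_zero`** — for every `ℂ`-submodule
  `M ⊆ Hʳ(A(ℂ); ℂ)` stable under the test pull-backs `(x·𝟙 + φ)^*`, `x ∈ ℕ` («`F^*` acts on …»): ONE non-zero rational
  class of `W_F ⊗ ℂ` in `M` ⟹ `W_F ⊗ ℂ ≤ M`.
* §3 HODGE CLASSES: **`forall_isOfHodgeType_weilClassesField_of_isRationalClass_of_ne_zero`** (one non-zero rational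
  class of `W_F ⊗ ℂ` of type `(p, q)` ⟹ every class of `W_F ⊗ ℂ` is of type `(p, q)`; pull-backs preserve Hodge types,
  `IsOfHodgeType.map_of_isSmoothProjective`) and the printed dichotomy
  **`weilClassesField_forall_isOfHodgeType_or_forall_eq_zero`**: «either all elements of `W_F` are Hodge classes, or
  `0 ∈ W_F` is the only Hodge class».  (Combined with the Criterion: the first case is `n_ρ = n_ρ̄` at every root,
  `forall_isOfHodgeType_weilClassesField_iff_balanced`.)  §3 also records that `W_F ⊗ ℂ` HAS non-zero rational classes
  (`exists_isRationalClass_ne_zero_mem_weilClassesField`), so the two cases exclude each other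
  (`weilClassesField_not_forall_isOfHodgeType_and_forall_eq_zero`).
* §4 EXCEPTIONAL versus DECOMPOSABLE: **`weilClassesField_le_divisorClassesSpan_of_isRationalClass_of_ne_zero`** (one
  non-zero rational decomposable class ⟹ `W_F ⊗ ℂ ≤ Dᵐ ⊗ ℂ`; `f^*(D ⊗ ℂ) ⊆ D ⊗ ℂ`,
  `AbelianVariety.map_mem_divisorClassesSpan`) and the printed dichotomy
  **`weilClassesField_le_divisorClassesSpan_or_forall_not_mem`**: «either `W_F ∖ {0}` consists entirely of exceptional
  classes, or none of the classes in `W_F` is exceptional» — `W_F ⊗ ℂ ≤ Dᵐ ⊗ ℂ`, or every non-zero rational class of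
  `W_F ⊗ ℂ` lies outside `Dᵐ ⊗ ℂ`.
* §5 ALGEBRAIC CLASSES: the same dichotomy **`weilClassesField_le_algebraicClasses_or_forall_not_mem`** (its «one class
  suffices» half is the tree's `weilClassesField_le_algebraicClasses_of_isRationalClass_of_ne_zero`, which §2 generalises).
* §6 THE PRINTED TRICHOTOMY for the rational Weil classes of `F`: **`weilClassesField_trichotomy`** — `0` is the only
  rational Hodge class of `W_F ⊗ ℂ`; or all of `W_F ⊗ ℂ` is Hodge and decomposable; or all of `W_F ⊗ ℂ` is Hodge and every
  non-zero rational Weil class is exceptional.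

PROOF OF §1 (the argument of `WeilClassesFieldOneClass`, sharpened from `≤` to a basis).  Choose `x₀ ∈ ℕ` with
`ρ ↦ (x₀ + ρ)ʳ` injective on the complex roots of `P` and let `M = minpoly_ℚ((x₀ + T)ʳ) ∈ ℚ[X]` over `K = ℚ[T]/(P)`:
irreducible, `M(T₀) = 0` on `W_F ⊗ ℂ` (each `⋀ʳ V_ρ` is a `T₀`-eigenspace for the root `(x₀ + ρ)ʳ` of `M`), and
`deg M ≥ e` (the `e` numbers `(x₀ + ρ)ʳ` are distinct roots).  The annihilator of `γ ≠ 0` in `ℚ[X]` is then `(M)`, so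
`γ, T₀γ, …, T₀^{e-1}γ` admit no rational relation, hence (rational classes, rational shadows of a complex relation:
`sum_dual_smul_eq_zero_of_isRationalClass`) no complex one; they lie in `W_F ⊗ ℂ`, whose dimension is `e`
(`Deligne1982.finrank_weilClassesField_eq_natDegree`). ∎  §2–§6 are formal consequences.

Honesty clause: dichotomies and transports only — no Weil class is proved Hodge, algebraic or decomposable outright.
No `sorry`; axioms `propext`, `Classical.choice`, `Quot.sound`.

## References
* [MoonenZarhin1998WeilClasses] B. J. J. Moonen, Yu. G. Zarhin, *Weil classes on abelian varieties*, J. reine angew.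
  Math. 496 (1998) 83–92 = arXiv:alg-geom/9612017, Introduction (decomposable / exceptional classes) and §1, section
  «all or nothing» (chunk p0001, lines 57–66); Criterion (ibid.).
* [vanGeemen1994HodgeAV] B. van Geemen, *An introduction to the Hodge conjecture for abelian varieties*, LNM 1594
  (1994), §2.4 (`D ⊗ ℂ` and pull-backs), 4.8–4.10 (the quadratic case), 6.12.
* [Deligne1982HodgeCycles] P. Deligne (notes by J. S. Milne), *Hodge cycles on abelian varieties*, LNM 900 (1982), §4
  (4.4) (`⋀^d_E H¹(A,ℚ) ↪ H^d(A,ℚ)`, `dim`), Prop. 4.4.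
* [Markman2025SurveySecant] E. Markman, arXiv:2509.23403 (2025), §4 p. 9 (the one-class argument for algebraic classes).
* [HatcherAT2002] A. Hatcher, *Algebraic Topology* (2002), §3.1 p. 198 (rational classes, pull-backs).
* [VoisinHodgeI2002] C. Voisin, *Hodge Theory and Complex Algebraic Geometry I* (2002), §7.3.2 (pull-backs preserve
  Hodge types).
-/

noncomputable section

open CategoryTheory Polynomial Module

namespace Literature.AlgebraicGeometry.HodgeTheory

open Literature.AlgebraicGeometry.Motives (AbelianVariety IsSmoothProjective)
open Literature.AlgebraicGeometry.Deligne1982 (finrank_weilClassesField_eq_natDegree)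
open Literature.AlgebraicTopology.SingularHomology
open Literature.Barriers.HodgeConjecture (divisorClassesSpan)

section HodgeTheory

variable {A : AbelianVariety ℂ} {φ : A ⟶ A} {P : Polynomial ℤ} {e r : ℕ}

/-! ### §1 `dim_F W_F = 1`: `W_F ⊗ ℂ` is the cyclic `ℂ[F^*]`-module on any non-zero rational Weil class -/

section Cyclic

/-- Arithmetic of the separating test endomorphism: there is `x₀ ∈ ℕ` such that `ρ ↦ (x₀ + ρ)ʳ` is injective on a
given finite set of complex numbers (`r ≠ 0`; a special case of `exists_nat_separating_prod`). [folklore] -/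
private theorem exists_nat_add_pow_injOn_finset (Z : Finset ℂ) (hr : r ≠ 0) :
    ∃ x₀ : ℕ, Set.InjOn (fun ρ : ℂ => ((x₀ : ℂ) + ρ) ^ r) (Z : Set ℂ) := by
  classical
  obtain ⟨x₀, hsep⟩ := exists_nat_separating_prod (N := Z.card) (fun i => (Z.equivFin.symm i : ℂ)) Z r
  refine ⟨x₀, fun ρ hρ ρ' hρ' h => ?_⟩
  let i : Fin r := ⟨0, Nat.pos_of_ne_zero hr⟩
  have h' : ∏ _j : Fin r, ((x₀ : ℂ) + (Z.equivFin.symm (Z.equivFin ⟨ρ, hρ⟩) : ℂ)) = ((x₀ : ℂ) + ρ') ^ r := by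
    rw [Finset.prod_const, Finset.card_univ, Fintype.card_fin, Equiv.symm_apply_apply]
    exact h
  have := hsep (fun _ => Z.equivFin ⟨ρ, hρ⟩) ρ' hρ' h' i
  rwa [Equiv.symm_apply_apply] at this

/-- **«`dim_F W_F = 1`» ON THE CARRIER: `W_F ⊗ ℂ` is the cyclic `ℂ[F^*]`-module generated by ANY non-zero RATIONAL
Weil class.**  Let `A` be a complex abelian variety, `φ : A ⟶ A` with `P(φ) = 0` in `End A` for `P ∈ ℤ[T]`
irreducible over `ℚ` of degree `e` (`F = ℚ(φ) ≅ ℚ[T]/(P) ⊂ End⁰(A)`), `r ≠ 0` with `e · r = 2 dim A`.  For every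
non-zero rational `γ ∈ W_F ⊗ ℂ = weilClassesField A φ P r` there is `x₀ ∈ ℕ` such that, with `T₀ = (x₀·𝟙 + φ)^*` on
`Hʳ(A(ℂ); ℂ)`, the classes `γ, T₀γ, …, T₀^{e-1}γ` are `ℂ`-linearly independent and span `W_F ⊗ ℂ` — the carrier form
of «`F^*` acts on `W_F` … `ρ(f)(w) = f^r · w` … `dim_F(W_F) = 1`»: the `F`-line `W_F = F · γ` complexifies to the
`ℂ[T₀]`-orbit of `γ`.  Proof in the module docstring. [cite: MoonenZarhin1998WeilClasses, §1 section «all or nothing»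
(chunk p0001, lines 57–66)] [cite: Deligne1982HodgeCycles, §4 (4.4)] [cite: Markman2025SurveySecant, §4 (p. 9)] -/
theorem exists_weilClassesField_eq_span_pow_apply_of_isRationalClass (hPe : P.natDegree = e)
    (hPirr : Irreducible (P.map (Int.castRingHom ℚ)))
    (hφ : Polynomial.eval₂ (Int.castRingHom (CategoryTheory.End A)) (φ : CategoryTheory.End A) P = 0)
    (her : e * r = 2 * A.dim) (hr : r ≠ 0) {γ : complexBetti A.X r} (hγW : γ ∈ weilClassesField A φ P r)
    (hγQ : IsRationalClass γ) (hγ0 : γ ≠ 0) :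
    ∃ x₀ : ℕ,
      LinearIndependent ℂ
          (fun j : Fin e => ((complexBetti.map (x₀ • 𝟙 A + 1 • φ).hom.hom.hom r).hom ^ (j : ℕ)) γ) ∧
        weilClassesField A φ P r = Submodule.span ℂ
          (Set.range fun j : Fin e => ((complexBetti.map (x₀ • 𝟙 A + 1 • φ).hom.hom.hom r).hom ^ (j : ℕ)) γ) := by
  classical
  have hX : IsSmoothProjective A.dim A.X := Motives.AbelianVariety.isSmoothProjective_holds (A := A)
  haveI := finite_complexBetti_abelianVariety A r
  have hP0 : P ≠ 0 := fun h => hPirr.ne_zero (by rw [h, Polynomial.map_zero])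
  let Z : Finset ℂ := (P.map (Int.castRingHom ℂ)).roots.toFinset
  have hZ : ∀ μ, μ ∈ Z ↔ Polynomial.eval₂ (Int.castRingHom ℂ) μ P = 0 := mem_roots_toFinset_map_iff hP0
  have hsepC : (P.map (Int.castRingHom ℂ)).Separable := by
    rw [map_castRingHom_complex_eq]; exact hPirr.separable.map
  have hZcard : Z.card = e := by
    rw [Multiset.toFinset_card_of_nodup (nodup_roots hsepC),
      ← (IsAlgClosed.splits (P.map (Int.castRingHom ℂ))).natDegree_eq_card_roots,
      natDegree_map_eq_of_injective (RingHom.injective_int (Int.castRingHom ℂ)), hPe]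
  obtain ⟨x₀, hinj⟩ := exists_nat_add_pow_injOn_finset Z hr
  refine ⟨x₀, ?_⟩
  set T₀ : Module.End ℂ (complexBetti A.X r) := (complexBetti.map (x₀ • 𝟙 A + 1 • φ).hom.hom.hom r).hom
    with hT₀def
  -- `M = minpoly_ℚ ((x₀ + T)ʳ)` over `ℚ[T]/(P)`: irreducible, kills `W_F ⊗ ℂ`, has the `e` distinct roots `(x₀ + ρ)ʳ`
  haveI : Fact (Irreducible (P.map (Int.castRingHom ℚ))) := ⟨hPirr⟩
  haveI : FiniteDimensional ℚ (AdjoinRoot (P.map (Int.castRingHom ℚ))) :=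
    (AdjoinRoot.powerBasis hPirr.ne_zero).finite
  let g : AdjoinRoot (P.map (Int.castRingHom ℚ)) :=
    ((x₀ : AdjoinRoot (P.map (Int.castRingHom ℚ))) + AdjoinRoot.root (P.map (Int.castRingHom ℚ))) ^ r
  let M : Polynomial ℚ := minpoly ℚ g
  have hMirr : Irreducible M := minpoly.irreducible (Algebra.IsIntegral.isIntegral g)
  have hM0 : M ≠ 0 := hMirr.ne_zero
  have hMroot : ∀ ρ, Polynomial.eval₂ (Int.castRingHom ℂ) ρ P = 0 →
      (M.map (algebraMap ℚ ℂ)).eval (((x₀ : ℂ) + ρ) ^ r) = 0 := by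
    intro ρ hρ
    rw [Polynomial.eval_map, ← aeval_def]; exact aeval_minpoly_pow_eq_zero P x₀ r hρ
  have hMW : ∀ c ∈ weilClassesField A φ P r, aeval T₀ (M.map (algebraMap ℚ ℂ)) c = 0 :=
    fun c hc => aeval_hom_complexBetti_map_eq_zero_of_mem_weilClassesField x₀ hMroot hc
  have heM : e ≤ M.natDegree := by
    have hM'0 : M.map (algebraMap ℚ ℂ) ≠ 0 := (Polynomial.map_ne_zero_iff (algebraMap ℚ ℂ).injective).2 hM0
    have himg : Z.image (fun ρ : ℂ => ((x₀ : ℂ) + ρ) ^ r) ⊆ (M.map (algebraMap ℚ ℂ)).roots.toFinset := by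
      intro z hz
      obtain ⟨ρ, hρ, rfl⟩ := Finset.mem_image.1 hz
      rw [Multiset.mem_toFinset, mem_roots hM'0, IsRoot.def]
      exact hMroot ρ ((hZ ρ).1 hρ)
    calc e = Z.card := hZcard.symm
      _ = (Z.image (fun ρ : ℂ => ((x₀ : ℂ) + ρ) ^ r)).card := (Finset.card_image_of_injOn hinj).symm
      _ ≤ (M.map (algebraMap ℚ ℂ)).roots.toFinset.card := Finset.card_le_card himg
      _ ≤ Multiset.card (M.map (algebraMap ℚ ℂ)).roots := Multiset.toFinset_card_le _
      _ ≤ (M.map (algebraMap ℚ ℂ)).natDegree := card_roots' _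
      _ = M.natDegree := natDegree_map_eq_of_injective (algebraMap ℚ ℂ).injective _
  -- the annihilator of `γ` in `ℚ[X]` is the maximal ideal `(M)`
  have hann : ∀ f : Polynomial ℚ, aeval T₀ (f.map (algebraMap ℚ ℂ)) γ = 0 → M ∣ f := by
    intro f hf; by_contra hnd
    obtain ⟨a, b, hab⟩ := (hMirr.coprime_iff_not_dvd).2 hnd
    have h1 : aeval T₀ ((a * M + b * f).map (algebraMap ℚ ℂ)) γ = γ := by
      rw [hab, Polynomial.map_one, aeval_one, Module.End.one_apply]
    rw [Polynomial.map_add, Polynomial.map_mul, Polynomial.map_mul, map_add, aeval_mul, aeval_mul,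
      LinearMap.add_apply, Module.End.mul_apply, Module.End.mul_apply, hMW γ hγW, hf, map_zero, map_zero,
      add_zero] at h1
    exact hγ0 h1.symm
  -- the `e` rational classes `T₀ʲ γ`, `j < e`, are `ℂ`-linearly independent
  let v : Fin e → complexBetti A.X r := fun j => (T₀ ^ (j : ℕ)) γ
  have hvQ : ∀ j, IsRationalClass (v j) := fun j => isRationalClass_pow_hom_complexBetti_map _ _ hγQ
  have hli : LinearIndependent ℂ v := by
    rw [Fintype.linearIndependent_iff]
    intro gc hgc j
    have hψ : ∀ ψ : ℂ →ₗ[ℚ] ℚ, ψ (gc j) = 0 := by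
      intro ψ
      have h1 := sum_dual_smul_eq_zero_of_isRationalClass hvQ hgc ψ
      let f : Polynomial ℚ := ∑ i : Fin e, C (ψ (gc i)) * X ^ (i : ℕ)
      have hf : aeval T₀ (f.map (algebraMap ℚ ℂ)) γ = 0 := by
        have : aeval T₀ (f.map (algebraMap ℚ ℂ)) γ = ∑ i : Fin e, ((ψ (gc i) : ℚ) : ℂ) • v i := by
          simp only [f, Polynomial.map_sum, Polynomial.map_mul, Polynomial.map_C, Polynomial.map_pow,
            Polynomial.map_X, map_sum, map_mul, aeval_C, map_pow, aeval_X, LinearMap.sum_apply,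
            Module.End.mul_apply, Module.algebraMap_end_apply, eq_ratCast, v]
        rw [this]; exact h1
      have hf0 : f = 0 := Polynomial.eq_zero_of_dvd_of_degree_lt (hann f hf) (by
        rw [Polynomial.degree_eq_natDegree hM0]
        exact (degree_sum_fin_lt _).trans_le (by exact_mod_cast heM))
      have hcoeff : f.coeff j = ψ (gc j) := by
        simp only [f, finsetSum_coeff, coeff_C_mul_X_pow]
        rw [Finset.sum_eq_single j]
        · simp
        · intro i _ hij
          rw [if_neg (fun h => hij (Fin.ext h).symm)]
        · intro hj; exact absurd (Finset.mem_univ j) hj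
      rw [← hcoeff, hf0, coeff_zero]
    exact (forall_dual_apply_eq_zero_iff ℚ (gc j)).1 hψ
  refine ⟨hli, ?_⟩
  -- they lie in `W_F ⊗ ℂ`, of dimension `e`: so they span it
  let Zs : Submodule ℂ (complexBetti A.X r) := Submodule.span ℂ (Set.range v)
  have hZsW : Zs ≤ weilClassesField A φ P r := Submodule.span_le.2 (by
    rintro _ ⟨j, rfl⟩; exact pow_hom_complexBetti_map_mem_weilClassesField x₀ 1 j hγW)
  have hZsrank : finrank ℂ Zs = e := by rw [finrank_span_eq_card hli, Fintype.card_fin]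
  have hWrank : finrank ℂ (weilClassesField A φ P r) = e :=
    finrank_weilClassesField_eq_natDegree hX φ hPe hPirr hφ her hr
  exact (Submodule.eq_of_le_of_finrank_le hZsW (by rw [hWrank, hZsrank])).symm

end Cyclic

/-! ### §2 The general one-class lemma: `F^*`-stable systems -/

section OneClass

/-- **THE GENERAL ONE-CLASS LEMMA («`F^*` acts on … and on the subspace `W_F` … `dim_F(W_F) = 1`»).**  With `A`, `φ`,
`P` irreducible of degree `e`, `P(φ) = 0`, `r ≠ 0`, `e · r = 2 dim A` as in §1: let `M ⊆ Hʳ(A(ℂ); ℂ)` be ANY complex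
subspace stable under the test pull-backs `(x·𝟙 + φ)^*`, `x ∈ ℕ` (e.g. the Hodge classes of a given type, the
complexified divisor ring, the algebraic classes, the kernel of a push-forward …).  If `M` contains ONE non-zero
RATIONAL class of `W_F ⊗ ℂ = weilClassesField A φ P r`, then `W_F ⊗ ℂ ≤ M` (by §1, `W_F ⊗ ℂ` is spanned by the
`T₀`-orbit of that class). [cite: MoonenZarhin1998WeilClasses, §1 section «all or nothing» (chunk p0001, lines 57–66)]
[cite: Markman2025SurveySecant, §4 (p. 9)] -/
theorem weilClassesField_le_of_isRationalClass_of_ne_zero (hPe : P.natDegree = e)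
    (hPirr : Irreducible (P.map (Int.castRingHom ℚ)))
    (hφ : Polynomial.eval₂ (Int.castRingHom (CategoryTheory.End A)) (φ : CategoryTheory.End A) P = 0)
    (her : e * r = 2 * A.dim) (hr : r ≠ 0) {M : Submodule ℂ (complexBetti A.X r)}
    (hM : ∀ x : ℕ, ∀ c ∈ M, (complexBetti.map (x • 𝟙 A + 1 • φ).hom.hom.hom r).hom c ∈ M)
    {γ : complexBetti A.X r} (hγW : γ ∈ weilClassesField A φ P r) (hγQ : IsRationalClass γ) (hγ0 : γ ≠ 0)
    (hγM : γ ∈ M) : weilClassesField A φ P r ≤ M := by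
  obtain ⟨x₀, -, hW⟩ := exists_weilClassesField_eq_span_pow_apply_of_isRationalClass hPe hPirr hφ her hr hγW hγQ hγ0
  have hpow : ∀ (j : ℕ) (c : complexBetti A.X r), c ∈ M →
      ((complexBetti.map (x₀ • 𝟙 A + 1 • φ).hom.hom.hom r).hom ^ j) c ∈ M := by
    intro j
    induction j with
    | zero => intro c hc; rwa [pow_zero, Module.End.one_apply]
    | succ j ih => intro c hc; rw [pow_succ, Module.End.mul_apply]; exact ih _ (hM x₀ c hc)
  rw [hW, Submodule.span_le]
  rintro _ ⟨j, rfl⟩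
  exact hpow j γ hγM

/-- The one-class lemma for a subspace stable under pull-back along EVERY endomorphism of `A` (the shape in which
the Hodge, divisor and algebraic systems are stable). [cite: MoonenZarhin1998WeilClasses, §1 section «all or nothing»
(chunk p0001, lines 57–66)] -/
theorem weilClassesField_le_of_forall_map_mem_of_isRationalClass_of_ne_zero (hPe : P.natDegree = e)
    (hPirr : Irreducible (P.map (Int.castRingHom ℚ)))
    (hφ : Polynomial.eval₂ (Int.castRingHom (CategoryTheory.End A)) (φ : CategoryTheory.End A) P = 0)
    (her : e * r = 2 * A.dim) (hr : r ≠ 0) {M : Submodule ℂ (complexBetti A.X r)}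
    (hM : ∀ g : A ⟶ A, ∀ c ∈ M, (complexBetti.map g.hom.hom.hom r).hom c ∈ M)
    {γ : complexBetti A.X r} (hγW : γ ∈ weilClassesField A φ P r) (hγQ : IsRationalClass γ) (hγ0 : γ ≠ 0)
    (hγM : γ ∈ M) : weilClassesField A φ P r ≤ M :=
  weilClassesField_le_of_isRationalClass_of_ne_zero hPe hPirr hφ her hr (fun _ => hM _) hγW hγQ hγ0 hγM

end OneClass

/-! ### §3 Hodge classes: «either all elements of `W_F` are Hodge classes, or `0` is the only Hodge class» -/

section Hodge

/-- **One non-zero rational class of type `(p, q)` in `W_F ⊗ ℂ` ⟹ every class of `W_F ⊗ ℂ` is of type `(p, q)`**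
(`r ≠ 0`, `e · r = 2 dim A`; the classes of type `(p, q)` form a complex subspace stable under pull-backs along
endomorphisms, Voisin I §7.3.2). [cite: MoonenZarhin1998WeilClasses, §1 section «all or nothing» (chunk p0001, lines
57–66)] [cite: VoisinHodgeI2002, §7.3.2] -/
theorem forall_isOfHodgeType_weilClassesField_of_isRationalClass_of_ne_zero {p q : ℕ} (hPe : P.natDegree = e)
    (hPirr : Irreducible (P.map (Int.castRingHom ℚ)))
    (hφ : Polynomial.eval₂ (Int.castRingHom (CategoryTheory.End A)) (φ : CategoryTheory.End A) P = 0)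
    (her : e * r = 2 * A.dim) (hr : r ≠ 0) {γ : complexBetti A.X r} (hγW : γ ∈ weilClassesField A φ P r)
    (hγQ : IsRationalClass γ) (hγ0 : γ ≠ 0) (hγH : IsOfHodgeType A.dim A.X r p q γ) :
    ∀ c ∈ weilClassesField A φ P r, IsOfHodgeType A.dim A.X r p q c := by
  have hX : IsSmoothProjective A.dim A.X := Motives.AbelianVariety.isSmoothProjective_holds (A := A)
  obtain ⟨Mdl⟩ := nonempty_hodgeModel_holds hX
  let M : Submodule ℂ (complexBetti A.X r) :=
    { carrier := {c | IsOfHodgeType A.dim A.X r p q c}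
      add_mem' := fun ha hb => ha.add hX hb
      zero_mem' := IsOfHodgeType.zero Mdl r p q
      smul_mem' := fun t _ hc => hc.smul t }
  have hM : ∀ g : A ⟶ A, ∀ c ∈ M, (complexBetti.map g.hom.hom.hom r).hom c ∈ M :=
    fun g c hc => IsOfHodgeType.map_of_isSmoothProjective hc hX hX g.hom.hom.hom
  intro c hc
  exact weilClassesField_le_of_forall_map_mem_of_isRationalClass_of_ne_zero hPe hPirr hφ her hr hM hγW hγQ hγ0
    (show γ ∈ M from hγH) hc

/-- **«Either all elements of `W_F` are Hodge classes, or `0 ∈ W_F` is the only Hodge class»** (Moonen–Zarhin §1, as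
printed; type `(p, q)` arbitrary, `r ≠ 0`, `e · r = 2 dim A`): every class of `W_F ⊗ ℂ` is of type `(p, q)`, or every
RATIONAL class of `W_F ⊗ ℂ` of type `(p, q)` is `0`. [cite: MoonenZarhin1998WeilClasses, §1 section «all or nothing»
(chunk p0001, lines 57–66)] -/
theorem weilClassesField_forall_isOfHodgeType_or_forall_eq_zero {p q : ℕ} (hPe : P.natDegree = e)
    (hPirr : Irreducible (P.map (Int.castRingHom ℚ)))
    (hφ : Polynomial.eval₂ (Int.castRingHom (CategoryTheory.End A)) (φ : CategoryTheory.End A) P = 0)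
    (her : e * r = 2 * A.dim) (hr : r ≠ 0) :
    (∀ c ∈ weilClassesField A φ P r, IsOfHodgeType A.dim A.X r p q c) ∨
      ∀ c ∈ weilClassesField A φ P r, IsRationalClass c → IsOfHodgeType A.dim A.X r p q c → c = 0 := by
  by_cases h : ∃ γ ∈ weilClassesField A φ P r, IsRationalClass γ ∧ IsOfHodgeType A.dim A.X r p q γ ∧ γ ≠ 0
  · obtain ⟨γ, hγW, hγQ, hγH, hγ0⟩ := h
    exact Or.inl
      (forall_isOfHodgeType_weilClassesField_of_isRationalClass_of_ne_zero hPe hPirr hφ her hr hγW hγQ hγ0 hγH)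
  · push Not at h
    exact Or.inr h

/-- **`W_F` has non-zero elements**: `W_F ⊗ ℂ` contains a non-zero RATIONAL class (`e · r = 2 dim A`, `P` monic
irreducible, `P(φ) = 0`): `W_F ⊗ ℂ` is spanned by its rational classes (`weilClassesField_eq_span_isRationalClass`) and
contains the non-zero line `⋀ʳ V_ρ` above any complex root `ρ` of `P` (`exists_generator_pullbackEigenclasses_of_root`).
[cite: MoonenZarhin1998WeilClasses, §1 (W_F = ⋀^r_F V_X is 1-dimensional over F; chunk p0001)]
[cite: Deligne1982HodgeCycles, §4 (4.4)] -/
theorem exists_isRationalClass_ne_zero_mem_weilClassesField (hPm : P.Monic) (hPe : P.natDegree = e)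
    (hPirr : Irreducible (P.map (Int.castRingHom ℚ)))
    (hφ : Polynomial.eval₂ (Int.castRingHom (CategoryTheory.End A)) (φ : CategoryTheory.End A) P = 0)
    (her : e * r = 2 * A.dim) :
    ∃ γ ∈ weilClassesField A φ P r, IsRationalClass γ ∧ γ ≠ 0 := by
  by_contra h
  push Not at h
  have hW : weilClassesField A φ P r = ⊥ := by
    rw [weilClassesField_eq_span_isRationalClass hPirr hφ r, Submodule.span_eq_bot]
    rintro c ⟨hcQ, hcW⟩
    exact h c hcW hcQ
  -- a complex root `ρ` of `P` exists (`deg P = e ≥ 1`), and `⋀ʳ V_ρ ≠ 0` lies in `W_F ⊗ ℂ = 0`: absurd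
  have hP0 : P ≠ 0 := fun h0 => hPirr.ne_zero (by rw [h0, Polynomial.map_zero])
  have hdeg : (P.map (Int.castRingHom ℂ)).degree ≠ 0 := by
    have h1 := degree_pos_of_irreducible hPirr
    rw [degree_map_eq_of_injective (RingHom.injective_int _)] at h1
    rw [degree_map_eq_of_injective (RingHom.injective_int _)]
    exact ne_of_gt h1
  obtain ⟨ρ, hρ⟩ := IsAlgClosed.exists_root (P.map (Int.castRingHom ℂ)) hdeg
  have hρ' : Polynomial.eval₂ (Int.castRingHom ℂ) ρ P = 0 := by rw [← Polynomial.eval_map]; exact hρ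
  obtain ⟨ω, hω, hω0, -, -⟩ := exists_generator_pullbackEigenclasses_of_root hPm hPe hPirr hφ her hρ'
  have hωW := pullbackEigenclasses_le_weilClassesField (A := A) (φ := φ) (r := r) hρ' hω
  rw [hW, Submodule.mem_bot] at hωW
  exact hω0 hωW

/-- The two cases of the Hodge dichotomy EXCLUDE each other (`W_F` has non-zero rational elements): it is not the
case that all of `W_F ⊗ ℂ` is of type `(p, q)` while every rational class of that type in it vanishes.
[cite: MoonenZarhin1998WeilClasses, §1 section «all or nothing» (chunk p0001, lines 57–66)] -/
theorem weilClassesField_not_forall_isOfHodgeType_and_forall_eq_zero {p q : ℕ} (hPm : P.Monic)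
    (hPe : P.natDegree = e) (hPirr : Irreducible (P.map (Int.castRingHom ℚ)))
    (hφ : Polynomial.eval₂ (Int.castRingHom (CategoryTheory.End A)) (φ : CategoryTheory.End A) P = 0)
    (her : e * r = 2 * A.dim) :
    ¬ ((∀ c ∈ weilClassesField A φ P r, IsOfHodgeType A.dim A.X r p q c) ∧
        ∀ c ∈ weilClassesField A φ P r, IsRationalClass c → IsOfHodgeType A.dim A.X r p q c → c = 0) := by
  rintro ⟨hall, hnone⟩
  obtain ⟨γ, hγW, hγQ, hγ0⟩ := exists_isRationalClass_ne_zero_mem_weilClassesField hPm hPe hPirr hφ her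
  exact hγ0 (hnone γ hγW hγQ (hall γ hγW))

/-- **The first case of the dichotomy is Moonen–Zarhin's Criterion** (type `(r/2, r/2)`): a non-zero rational Hodge
class exists in `W_F ⊗ ℂ` iff ALL of `W_F ⊗ ℂ` is Hodge iff `n_ρ = n_ρ̄` at every complex root of `P`
(`forall_isOfHodgeType_weilClassesField_iff_balanced`). [cite: MoonenZarhin1998WeilClasses, §1 («In view of the
remarks in section (allornothing) we obtain the following answer to question Q1» — Criterion; chunk p0001)] -/
theorem exists_isRationalClass_isOfHodgeType_ne_zero_iff_balanced (hPm : P.Monic) (hPe : P.natDegree = e)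
    (hPirr : Irreducible (P.map (Int.castRingHom ℚ)))
    (hφ : Polynomial.eval₂ (Int.castRingHom (CategoryTheory.End A)) (φ : CategoryTheory.End A) P = 0)
    (her : e * r = 2 * A.dim) (hr : r ≠ 0) :
    (∃ γ ∈ weilClassesField A φ P r,
        IsRationalClass γ ∧ IsOfHodgeType A.dim A.X r (r / 2) (r / 2) γ ∧ γ ≠ 0) ↔
      ∀ ρ : ℂ, Polynomial.eval₂ (Int.castRingHom ℂ) ρ P = 0 →
        eigenMultiplicity A φ ρ = eigenMultiplicity A φ (starRingEnd ℂ ρ) := by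
  rw [← forall_isOfHodgeType_weilClassesField_iff_balanced hPm hPe hPirr hφ her]
  constructor
  · rintro ⟨γ, hγW, hγQ, hγH, hγ0⟩
    exact forall_isOfHodgeType_weilClassesField_of_isRationalClass_of_ne_zero hPe hPirr hφ her hr hγW hγQ hγ0 hγH
  · intro hall
    obtain ⟨γ, hγW, hγQ, hγ0⟩ := exists_isRationalClass_ne_zero_mem_weilClassesField hPm hPe hPirr hφ her
    exact ⟨γ, hγW, hγQ, hall γ hγW, hγ0⟩

end Hodge

/-! ### §4 Exceptional versus decomposable: «either `W_F ∖ {0}` consists entirely of exceptional classes, or none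
of the classes in `W_F` is exceptional» -/

section Exceptional

variable {m : ℕ}

/-- **One non-zero rational DECOMPOSABLE Weil class ⟹ `W_F ⊗ ℂ ≤ Dᵐ ⊗ ℂ`** (`e · 2m = 2 dim A`, `m ≠ 0`): the
complexified divisor ring `Dᵐ ⊗ ℂ = divisorClassesSpan A.X A.dim m` is a complex subspace stable under pull-back along
endomorphisms (`AbelianVariety.map_mem_divisorClassesSpan`, van Geemen §2.4), so the general one-class lemma applies.
[cite: MoonenZarhin1998WeilClasses, §1 section «all or nothing» (chunk p0001, lines 57–66)]
[cite: vanGeemen1994HodgeAV, §2.4 (p. 235)] -/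
theorem weilClassesField_le_divisorClassesSpan_of_isRationalClass_of_ne_zero (hPe : P.natDegree = e)
    (hPirr : Irreducible (P.map (Int.castRingHom ℚ)))
    (hφ : Polynomial.eval₂ (Int.castRingHom (CategoryTheory.End A)) (φ : CategoryTheory.End A) P = 0)
    (her : e * (2 * m) = 2 * A.dim) (hm : m ≠ 0) {γ : complexBetti A.X (2 * m)}
    (hγW : γ ∈ weilClassesField A φ P (2 * m)) (hγQ : IsRationalClass γ) (hγ0 : γ ≠ 0)
    (hγD : γ ∈ divisorClassesSpan A.X A.dim m) :
    weilClassesField A φ P (2 * m) ≤ divisorClassesSpan A.X A.dim m :=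
  weilClassesField_le_of_forall_map_mem_of_isRationalClass_of_ne_zero hPe hPirr hφ her (by omega)
    (fun g _ hc => AbelianVariety.map_mem_divisorClassesSpan g hc) hγW hγQ hγ0 hγD

/-- **«Either `W_F ∖ {0}` consists entirely of exceptional classes, or none of the classes in `W_F` is exceptional»**
(Moonen–Zarhin §1, as printed; `e · 2m = 2 dim A`, `m ≠ 0`): `W_F ⊗ ℂ ≤ Dᵐ ⊗ ℂ` (no Weil class exceptional), or every
non-zero RATIONAL class of `W_F ⊗ ℂ` lies outside `Dᵐ ⊗ ℂ` (every non-zero Weil class exceptional — when they are Hodge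
classes at all, §3). [cite: MoonenZarhin1998WeilClasses, §1 section «all or nothing» (chunk p0001, lines 57–66) and
Introduction (decomposable / exceptional classes)] -/
theorem weilClassesField_le_divisorClassesSpan_or_forall_not_mem (hPe : P.natDegree = e)
    (hPirr : Irreducible (P.map (Int.castRingHom ℚ)))
    (hφ : Polynomial.eval₂ (Int.castRingHom (CategoryTheory.End A)) (φ : CategoryTheory.End A) P = 0)
    (her : e * (2 * m) = 2 * A.dim) (hm : m ≠ 0) :
    weilClassesField A φ P (2 * m) ≤ divisorClassesSpan A.X A.dim m ∨
      ∀ c ∈ weilClassesField A φ P (2 * m), IsRationalClass c → c ≠ 0 → c ∉ divisorClassesSpan A.X A.dim m := by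
  by_cases h : ∃ γ ∈ weilClassesField A φ P (2 * m), IsRationalClass γ ∧ γ ≠ 0 ∧ γ ∈ divisorClassesSpan A.X A.dim m
  · obtain ⟨γ, hγW, hγQ, hγ0, hγD⟩ := h
    exact Or.inl
      (weilClassesField_le_divisorClassesSpan_of_isRationalClass_of_ne_zero hPe hPirr hφ her hm hγW hγQ hγ0 hγD)
  · push Not at h
    exact Or.inr h

/-- The two cases of the exceptional dichotomy EXCLUDE each other (`W_F` has non-zero rational elements; `P` monic).
[cite: MoonenZarhin1998WeilClasses, §1 section «all or nothing» (chunk p0001, lines 57–66)] -/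
theorem weilClassesField_not_le_divisorClassesSpan_and_forall_not_mem (hPm : P.Monic) (hPe : P.natDegree = e)
    (hPirr : Irreducible (P.map (Int.castRingHom ℚ)))
    (hφ : Polynomial.eval₂ (Int.castRingHom (CategoryTheory.End A)) (φ : CategoryTheory.End A) P = 0)
    (her : e * (2 * m) = 2 * A.dim) :
    ¬ (weilClassesField A φ P (2 * m) ≤ divisorClassesSpan A.X A.dim m ∧
        ∀ c ∈ weilClassesField A φ P (2 * m), IsRationalClass c → c ≠ 0 → c ∉ divisorClassesSpan A.X A.dim m) := by
  rintro ⟨hall, hnone⟩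
  obtain ⟨γ, hγW, hγQ, hγ0⟩ := exists_isRationalClass_ne_zero_mem_weilClassesField hPm hPe hPirr hφ her
  exact hnone γ hγW hγQ hγ0 (hall hγW)

/-- **Exceptional Weil classes come all at once**: if ONE non-zero rational class of `W_F ⊗ ℂ` is exceptional (outside
`Dᵐ ⊗ ℂ`), then EVERY non-zero rational class of `W_F ⊗ ℂ` is exceptional (`e · 2m = 2 dim A`, `m ≠ 0`).
[cite: MoonenZarhin1998WeilClasses, §1 section «all or nothing» (chunk p0001, lines 57–66)] -/
theorem forall_not_mem_divisorClassesSpan_of_not_mem (hPe : P.natDegree = e)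
    (hPirr : Irreducible (P.map (Int.castRingHom ℚ)))
    (hφ : Polynomial.eval₂ (Int.castRingHom (CategoryTheory.End A)) (φ : CategoryTheory.End A) P = 0)
    (her : e * (2 * m) = 2 * A.dim) (hm : m ≠ 0) {δ : complexBetti A.X (2 * m)}
    (hδW : δ ∈ weilClassesField A φ P (2 * m)) (hδD : δ ∉ divisorClassesSpan A.X A.dim m) :
    ∀ c ∈ weilClassesField A φ P (2 * m), IsRationalClass c → c ≠ 0 → c ∉ divisorClassesSpan A.X A.dim m := by
  rcases weilClassesField_le_divisorClassesSpan_or_forall_not_mem hPe hPirr hφ her hm with hall | hnone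
  · exact absurd (hall hδW) hδD
  · exact hnone

end Exceptional

/-! ### §5 Algebraic classes: the same dichotomy -/

section Algebraic

variable {m : ℕ}

/-- **Algebraic dichotomy for the Weil classes of `F`** (`e · 2m = 2 dim A`, `0 < m`): `W_F ⊗ ℂ ≤ algebraicClasses`
(all Weil classes algebraic), or every non-zero RATIONAL class of `W_F ⊗ ℂ` is non-algebraic — «`K` acts on `H^*(A,ℚ)`
via algebraic correspondences and `HW(A,η′)` is 1-dimensional over `K`» (Markman), the «⟹» being the tree's one-class
lemma `weilClassesField_le_algebraicClasses_of_isRationalClass_of_ne_zero`. [cite: MoonenZarhin1998WeilClasses, §1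
section «all or nothing» (chunk p0001, lines 57–66)] [cite: Markman2025SurveySecant, §4 (p. 9)] -/
theorem weilClassesField_le_algebraicClasses_or_forall_not_mem (hPe : P.natDegree = e)
    (hPirr : Irreducible (P.map (Int.castRingHom ℚ)))
    (hφ : Polynomial.eval₂ (Int.castRingHom (CategoryTheory.End A)) (φ : CategoryTheory.End A) P = 0)
    (her : e * (2 * m) = 2 * A.dim) (hm : 0 < m) :
    weilClassesField A φ P (2 * m) ≤ algebraicClasses A.X m ∨
      ∀ c ∈ weilClassesField A φ P (2 * m), IsRationalClass c → c ≠ 0 → c ∉ algebraicClasses A.X m := by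
  by_cases h : ∃ γ ∈ weilClassesField A φ P (2 * m), IsRationalClass γ ∧ γ ≠ 0 ∧ γ ∈ algebraicClasses A.X m
  · obtain ⟨γ, hγW, hγQ, hγ0, hγalg⟩ := h
    exact Or.inl
      (weilClassesField_le_algebraicClasses_of_isRationalClass_of_ne_zero hPe hPirr hφ her hm hγW hγQ hγ0 hγalg)
  · push Not at h
    exact Or.inr h

end Algebraic

/-! ### §6 The printed trichotomy for the rational Weil classes of `F` -/

section Trichotomy

variable {m : ℕ}

/-- **MOONEN–ZARHIN'S TRICHOTOMY, AS PRINTED** («either all elements of `W_F` are Hodge classes, or `0 ∈ W_F` is the only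
Hodge class, and in the first case, either `W_F ∖ {0}` consists entirely of exceptional classes, or none of the classes
in `W_F` is exceptional»), on the carrier for `F = ℚ(φ)` of degree `e`, `e · 2m = 2 dim A`, `m ≠ 0`: (a) every rational
`(m, m)`-class of `W_F ⊗ ℂ` is `0`; or (b) all of `W_F ⊗ ℂ` is of type `(m, m)` and decomposable (`≤ Dᵐ ⊗ ℂ`); or (c) all
of `W_F ⊗ ℂ` is of type `(m, m)` and every non-zero rational class of it is exceptional (`∉ Dᵐ ⊗ ℂ`).  (Decomposable
classes are Hodge: `isOfHodgeType_of_mem_divisorClassesSpan`.) [cite: MoonenZarhin1998WeilClasses, §1 section «all or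
nothing» (chunk p0001, lines 57–66)] [cite: vanGeemen1994HodgeAV, §2.4] -/
theorem weilClassesField_trichotomy (hPe : P.natDegree = e) (hPirr : Irreducible (P.map (Int.castRingHom ℚ)))
    (hφ : Polynomial.eval₂ (Int.castRingHom (CategoryTheory.End A)) (φ : CategoryTheory.End A) P = 0)
    (her : e * (2 * m) = 2 * A.dim) (hm : m ≠ 0) :
    (∀ c ∈ weilClassesField A φ P (2 * m), IsRationalClass c → IsOfHodgeType A.dim A.X (2 * m) m m c → c = 0) ∨
      ((∀ c ∈ weilClassesField A φ P (2 * m), IsOfHodgeType A.dim A.X (2 * m) m m c) ∧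
          weilClassesField A φ P (2 * m) ≤ divisorClassesSpan A.X A.dim m) ∨
        ((∀ c ∈ weilClassesField A φ P (2 * m), IsOfHodgeType A.dim A.X (2 * m) m m c) ∧
          ∀ c ∈ weilClassesField A φ P (2 * m), IsRationalClass c → c ≠ 0 → c ∉ divisorClassesSpan A.X A.dim m) := by
  have hX : IsSmoothProjective A.dim A.X := Motives.AbelianVariety.isSmoothProjective_holds (A := A)
  rcases weilClassesField_forall_isOfHodgeType_or_forall_eq_zero (p := m) (q := m) hPe hPirr hφ her (by omega)
    with hall | hnone
  · rcases weilClassesField_le_divisorClassesSpan_or_forall_not_mem hPe hPirr hφ her hm with hD | hE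
    · exact Or.inr (Or.inl ⟨hall, hD⟩)
    · exact Or.inr (Or.inr ⟨hall, hE⟩)
  · exact Or.inl hnone

/-- **In the «`0` is the only Hodge class» case no Weil class is decomposable**: if every rational `(m, m)`-class of
`W_F ⊗ ℂ` vanishes then every non-zero rational class of `W_F ⊗ ℂ` lies outside `Dᵐ ⊗ ℂ` (decomposable classes are
Hodge). [cite: MoonenZarhin1998WeilClasses, Introduction (decomposable classes are Hodge, indeed algebraic) and §1]
[cite: vanGeemen1994HodgeAV, §2.4] -/
theorem forall_not_mem_divisorClassesSpan_of_forall_eq_zero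
    (h0 : ∀ c ∈ weilClassesField A φ P (2 * m), IsRationalClass c → IsOfHodgeType A.dim A.X (2 * m) m m c → c = 0) :
    ∀ c ∈ weilClassesField A φ P (2 * m), IsRationalClass c → c ≠ 0 → c ∉ divisorClassesSpan A.X A.dim m := by
  have hX : IsSmoothProjective A.dim A.X := Motives.AbelianVariety.isSmoothProjective_holds (A := A)
  intro c hcW hcQ hc0 hcD
  exact hc0 (h0 c hcW hcQ (isOfHodgeType_of_mem_divisorClassesSpan hX hcD))

end Trichotomy

end HodgeTheory

end Literature.AlgebraicGeometry.HodgeTheory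

end
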